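import Summits.CriticalPhenomena.PercolationContinuityZ3.Theorems.Transplant.SkelAdvPackaging
import Summits.CriticalPhenomena.PercolationContinuityZ3.Theorems.Transplant.SkelTubeSub
import Summits.CriticalPhenomena.PercolationContinuityZ3.Theorems.Transplant.SkelCellsConcGLevels
import HarnessLib

/-!
# L6 (R), file 1: the ROOT RESIDUE `Skel.RootOblA` (stmt-g7's `SkelAdvPackaging`; ⟹ `Skel.RootOblT` by `Skel.rootOblT_of_rootOblA`) for the
# concentric scheme of record `⟨Skel.cellGeomSG Φ C t Λ, q, δc⟩` (= stmt-g7's abbrev `SkelConc.concSchemeSG`, rfl-transparent) over a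
# `PlanarSkeletonConc`, from ONE straight-run WINDOW chain per
# direction `du` in the window graph `winGraph G t Rπ` — generic twin of p2-g2's `KNCellsBoxProdZ2ConcRoot` (`rootOblA_concG`, p222878-era)

builds on p205010 (kernel theorem, internal audit signed; external expert review pending) — nothing in this file uses p205010.
Status sentence (coordinator 2026-08-20T04:30Z): "θ(p_c) = 0 on ℤ^d, all d ≥ 2 — kernel-verified (Lean 4/Mathlib, standard axioms); internal
adversarial audit SIGNED 2026-08-20 04:29Z; external expert review pending."
Lane `prim-bschramm-*`, seat `prim-bschramm-p2` (gen 4; (R) = p2 lineage, SHEAR-SCOPE §3.9 Layer 6); helper file (`--supports stmt-CriticalPhenomena-4575`).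

DICTIONARY (SHEAR-SCOPE §3.1 / §p2): `(w₀, 0) ↦ t` (the root IS the window centre, `Φ.φ t = 0`), `ballFin X w₀ Rt ×ˢ A ↦ Φ.Win t A Rπ`
(`WinAdvData.stepD/coreT`), `tubeGraph X π ↦ Skel.winGraph G t Rπ`, `U.filter (·.1 ∈ π) ↦ U.filter (· ∈ B_G(t, Rπ))`, `TubeAdvData ↦ Skel.WinAdvData`,
`isSubbox_W0sub_tube ↦ Skel.isSubbox_W0sub_win` (p232642).  TWO generic differences, both forced by the regions of record being VERTEX SPANS
`Φ.VWin` (SkelCellsConcG) while the run's regions are plain windows `Φ.Win`: (1) the three radius facts carry ONE UNIT OF SLACK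
(`Rπ + 1 ≤ rB 0 0 du`, `Rπ + 1 ≤ rQ 0 (0+du)`, `Rπ + 1 ≤ rM 0 (0+du)`) — the step device `mem_VWin_of_zdAdj` + planar self-adjacency of
`BtwN` / `Q` / `M` puts every window vertex into the span; (2) the between-box is the NARROW one (`C.BtwN`, hp-8 g22), so the planar fact reads
`aregion k ⊆ C.BtwN 0 du ∪ C.Q (0 + du)`.  The nonemptiness of the true targets `coreT k` is a hypothesis here (stmt-g7's `RootOblA` clause;
discharged at the run level from (ι) `step` once `Rπ` dominates the planar ℓ¹-extent of the run, file 2 `SkelConcRootRun`).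

THE FACTS per direction `du` (child `y = 0 + du`): radii as above; planar: every region `aregion k ⊆ C.BtwN 0 du ∪ C.Q y` and
`Disjoint (aregion k) (C.Q 0)` (`k ≤ nA`), the far face `acore (nA + 1) ⊆ C.M y`.  Then the cut root world `U' := (Q_0 ∪ E_{0,du}).filter
(· ∈ B_G(t, Rπ))` carries every region, the root law cut to `U'` is a subbox weighting of the window graph on each region, the root `t` is off
every region, and the far face lies in `M_0(y)`.
* `PCells.exists_adj_of_mem_M` (planar self-adjacency of `M_v`, side `6r ≥ 1`);
* **`Skel.rootOblA_concSG`** — `Skel.RootOblA Φ ⟨Skel.cellGeomSG Φ C t Λ, q, δc⟩ Δ' δr` from `du`-indexed data `P du : WinAdvData V`, `B₀ du`, `η du`.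
[cite: KozmaNitzan2024, §4 p. 27 (G₀), p. 28 ((32) at the root), Lemma 11 (pp. 22–23)]
-/

noncomputable section

open MeasureTheory ProbabilityTheory
open scoped ENNReal Classical

namespace Summit.CriticalPhenomena.PercolationContinuityZ3.Theorems

namespace Transplant


/-! ## §0 One planar supplement -/

namespace PCells

open Literature.Probability.Percolation Literature.Probability.LatticeModels SimpleGraph

/-- Self-adjacency of the target square `M_v = cen v + [-3r, 3r]²` (side `6r ≥ 1`). [folklore] -/
theorem exists_adj_of_mem_M (C : PCells) (v : Site 2) {t : Site 2} (ht : t ∈ C.M v) : ∃ t' ∈ C.M v, (zdGraph 2).Adj t t' :=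
  exists_adj_of_mem_Icc 0 (by simp only [Pi.sub_apply, Pi.add_apply, Pi.natCast_apply]; push_cast; have := C.one_le_r; omega) ht

end PCells

namespace Skel

open Literature.Probability.Percolation Literature.Probability.LatticeModels SimpleGraph GadgetSystem ProbeHistory HSiteScheme Contour KNCells
open KNCells.KSchA PlanarSkeletonConc
open Literature.Barriers.CriticalPhenomena (graphBall mem_graphBall_self)
open BoxProdZ2 (ConcRadiiG)

variable {V : Type} [DecidableEq V] {G : SimpleGraph V} [G.LocallyFinite] (Φ : PlanarSkeletonConc G)

/-! ## §1 The root residue of the concentric scheme of record -/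

/-- **THE ROOT RESIDUE OF THE CONCENTRIC SCHEME OF RECORD** (design (D), (R), generic): `Skel.RootOblA` from one straight window run per
direction in `winGraph G t Rπ` avoiding the wired root cube, three radius facts (with the step device's unit of slack), three planar facts
(narrow between-box), and — as hypotheses — the per-step kit clauses, the rim excess, the first hop and the count.
[cite: KozmaNitzan2024, §4 p. 28 ((32) at the root), Lemma 11 (pp. 22–23)] -/
theorem rootOblA_concSG (C : PCells) (t : V) {Λ : ConcRadiiG} (hΛ : WFS C Λ) (hφ : Φ.φ t = 0) (q : unitInterval) (δc : ℝ)
    {Δ' : ℕ} {δr : ℕ → ℝ} (P : MDir → WinAdvData V) (B₀ : MDir → Finset V) (η : MDir → ℝ)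
    -- the data of the runs
    (hProot : ∀ du, (P du).root = t)
    (hPS : ∀ du, (P du).Sfin =
      ((⟨cellGeomSG Φ C t Λ, q, δc⟩ : KSchA V ℕ).U0root du).filter fun y => y ∈ graphBall G t (P du).Rπ)
    (hsg : ∀ du, (P du).sg = 1 ∨ (P du).sg = -1)
    (hOK : ∀ du, ChainPlanar.Adv.AdvOK (P du).q (P du).q' (P du).s₁ (P du).ρ (P du).R' (P du).ℓ₀ (P du).nA)
    (hRl : ∀ du, (P du).Rlev + 1 ≤ (P du).R') (hRim : ∀ du k, (P du).Rim k ⊆ (P du).stepD Φ k) (hj : ∀ du, (P du).j₁ ≤ (P du).Rlev)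
    (hTne : ∀ du, ∀ k ≤ (P du).nA, ((P du).coreT Φ k).Nonempty)
    -- three radius facts (one unit of slack: the regions of record are vertex spans)
    (hRB : ∀ du, (P du).Rπ + 1 ≤ Λ.rB 0 0 du) (hRQ : ∀ du, (P du).Rπ + 1 ≤ Λ.rQ 0 ((0 : Site 2) + stepVec du))
    (hRM : ∀ du, (P du).Rπ + 1 ≤ Λ.rM 0 ((0 : Site 2) + stepVec du))
    -- three planar facts (narrow between-box)
    (hreg : ∀ du, ∀ k ≤ (P du).nA, (P du).aregion k ⊆ C.BtwN 0 du ∪ C.Q ((0 : Site 2) + stepVec du))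
    (hQ0 : ∀ du, ∀ k ≤ (P du).nA, Disjoint ((P du).aregion k) (C.Q 0))
    (hlast : ∀ du, (P du).acore ((P du).nA + 1) ⊆ C.M ((0 : Site 2) + stepVec du))
    -- the analytic inputs
    (hcount : ∀ du, 1 / (1 - (q : ℝ)) ^ (Δ' * (P du).N) ≤ δr (P du).nA * ((Finset.Icc (P du).j₀ (P du).j₁).card : ℝ))
    (hkits : ∀ du, ∀ k ≤ (P du).nA, ∀ j ∈ Finset.Icc (P du).j₀ (P du).j₁, ∃ (σ : KNLevels.SData V) (Sz : Finset V),
      KNLevels.SHyp (winLData Φ (P du).root (P du).Rπ ((P du).alo k) ((P du).ahi k) (P du).root (P du).Sfin) j σ ∧ σ.N ≤ (P du).N ∧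
      (1 - (q : ℝ) ^ σ.sB) ^ σ.k ≤ δr (P du).nA ∧
      Sz ⊆ (winLData Φ (P du).root (P du).Rπ ((P du).alo k) ((P du).ahi k) (P du).root (P du).Sfin).X j ∧ Sz ⊆ (P du).stepD Φ k ∧
      (∀ x ∈ σ.K, ∀ e' ∈ σ.seed x, e' ∉ wireSet (↑Sz : Set V)) ∧ (∀ x ∈ σ.K, σ.face x ⊆ Sz) ∧
      (∀ x ∈ σ.K, 1 - 3 * δr (P du).nA ≤ (prodBernoulli ((⟨cellGeomSG Φ C t Λ, q, δc⟩ : KSchA V ℕ).W0sub G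
          (((⟨cellGeomSG Φ C t Λ, q, δc⟩ : KSchA V ℕ).U0root du).filter fun y => y ∈ graphBall G t (P du).Rπ))).real {ω | ∃ u ∈ σ.face x,
        1 - δr (P du).nA < (prodBernoulli (pinW ((⟨cellGeomSG Φ C t Λ, q, δc⟩ : KSchA V ℕ).W0sub G
          (((⟨cellGeomSG Φ C t Λ, q, δc⟩ : KSchA V ℕ).U0root du).filter fun y => y ∈ graphBall G t (P du).Rπ))
          (wireSet (↑Sz : Set V)) ω)).real
          (⋃ t' ∈ (P du).coreE Φ k, openConnIn (↑((P du).stepD Φ k) : Set V) u t')}))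
    (hη : ∀ du, η du ≤ δr (P du).nA / 2)
    (hexc : ∀ du, ∀ k ≤ (P du).nA, (prodBernoulli ((⟨cellGeomSG Φ C t Λ, q, δc⟩ : KSchA V ℕ).W0sub G
        (((⟨cellGeomSG Φ C t Λ, q, δc⟩ : KSchA V ℕ).U0root du).filter fun y => y ∈ graphBall G t (P du).Rπ))).real
        (⋃ t' ∈ (P du).Rim k, openConn t t') ≤ η du)
    (hB₀ : ∀ du, B₀ du ⊆ ((P du).stepL Φ 0).X 0)
    (hsrc : ∀ du, 1 - δr (P du).nA < (prodBernoulli ((⟨cellGeomSG Φ C t Λ, q, δc⟩ : KSchA V ℕ).W0sub G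
        (((⟨cellGeomSG Φ C t Λ, q, δc⟩ : KSchA V ℕ).U0root du).filter fun y => y ∈ graphBall G t (P du).Rπ))).real
        (⋃ t' ∈ B₀ du, openConn t t')) :
    RootOblA Φ (⟨cellGeomSG Φ C t Λ, q, δc⟩ : KSchA V ℕ) Δ' δr := by
  intro du
  set S := (⟨cellGeomSG Φ C t Λ, q, δc⟩ : KSchA V ℕ) with hSdef
  set U' : Finset V := (S.U0root du).filter fun y => y ∈ graphBall G t (P du).Rπ with hU'
  have hr := hProot du
  have ht : t ∈ graphBall G t (P du).Rπ := mem_graphBall_self G t _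
  -- the root lies in its cube (a span: `1 ≤ rQ 0 0`, `φ t = 0`, `e₀ ∈ Q_0`)
  have hrootQ : t ∈ S.Γ.Q S.Γ.a₀ 0 := (sepGeomSG Φ C t hΛ hφ).root_mem
  have hrootU : t ∈ U' := Finset.mem_filter.2 ⟨Finset.mem_union_left _ hrootQ, ht⟩
  -- every region lies in the cut root world (the step device puts a window vertex into the span)
  have hDU : ∀ k ≤ (P du).nA, (P du).stepD Φ k ⊆ U' := by
    intro k hk v hv
    rw [WinAdvData.stepD, hr, Φ.mem_Win] at hv
    obtain ⟨hd, hφv⟩ := hv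
    refine Finset.mem_filter.2 ⟨?_, hd⟩
    rcases Finset.mem_union.1 (hreg du k hk hφv) with h | h
    · -- the narrow between-box `BtwN_0(0, du)`
      refine Finset.mem_union_right _ (Finset.mem_union_left _ ?_)
      change v ∈ Φ.VWin t (C.BtwN 0 du) (Λ.rB 0 0 du)
      exact Φ.mem_VWin_of_zdAdj hd (hRB du) h (C.exists_adj_of_mem_BtwN 0 du h)
    · -- the child's cube `Q_0(0 + du)`
      refine Finset.mem_union_right _ (Finset.mem_union_right _ ?_)
      change v ∈ Φ.VWin t (C.Q ((0 : Site 2) + stepVec du)) (Λ.rQ 0 ((0 : Site 2) + stepVec du))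
      exact Φ.mem_VWin_of_zdAdj hd (hRQ du) h (C.exists_adj_of_mem_Q _ h)
  -- … and off the wired root cube (planar footprints)
  have hdis : ∀ k ≤ (P du).nA, Disjoint ((P du).stepD Φ k) (S.Γ.Q S.Γ.a₀ 0) := by
    intro k hk
    change Disjoint (Φ.Win (P du).root ((P du).aregion k) (P du).Rπ) (Φ.VWin t (C.Q 0) (Λ.rQ 0 0))
    exact disjoint_of_φ (fun a ha => (Φ.mem_Win.1 ha).2) (fun b hb => φ_mem_of_mem_VWin hb) (hQ0 du k hk)
  refine ⟨P du, U', B₀ du, η du, hsg du, hOK du, hRl du, hRim du, hTne du, ?_, Finset.filter_subset _ _, hrootU, ?_, ?_, ?_, ?_, ?_,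
    hj du, hcount du, ?_, hη du, ?_, hB₀ du, ?_, ?_⟩
  · -- the sources agree
    rw [hr]; rfl
  · -- subbox in the window graph
    intro k hk
    rw [hr]
    exact isSubbox_W0sub_win G t (P du).Rπ (S := S) (U := S.U0root du) (hDU k hk) (hdis k hk)
  · -- finite support
    rw [hPS]; exact finSupp_W0sub
  · -- regions inside the support
    intro k hk; rw [hPS]; exact hDU k hk
  · -- the root is off every region
    intro k hk; rw [hr]
    exact fun h' => Finset.disjoint_left.1 (hdis k hk) h' hrootQ
  · -- the root is in the support
    rw [hr, hPS]; exact hrootU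
  · -- the kit clauses
    intro k hk j hjj
    exact hkits du k hk j hjj
  · -- the rim excess
    intro k hk; exact hexc du k hk
  · -- the first hop
    exact hsrc du
  · -- the far face lies in `M_0(0 + du)` (a span: step device, slack `Rπ + 1 ≤ rM`)
    intro v hv
    rw [WinAdvData.coreT, hr, Φ.mem_Win] at hv
    obtain ⟨hd, hφv⟩ := hv
    have h := hlast du hφv
    change v ∈ Φ.VWin t (C.M ((0 : Site 2) + stepVec du)) (Λ.rM 0 ((0 : Site 2) + stepVec du))
    exact Φ.mem_VWin_of_zdAdj hd (hRM du) h (C.exists_adj_of_mem_M _ h)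

end Skel

end Transplant

end Summit.CriticalPhenomena.PercolationContinuityZ3.Theorems

end
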